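import Literature.NumberTheory.EllipticCurves.ArtinFormalismRelativeQuadraticLocalProofs
import Literature.NumberTheory.EllipticCurves.ArtinFormalismAbelianEulerProofs
import Literature.NumberTheory.EllipticCurves.LFunctionSmulProofs
import Literature.NumberTheory.EllipticCurves.QuadraticTwistPadicReduction
import HarnessLib

/-!
# The local Artin identity above a place where a quadratic twist of `E` is semistable

`Proofs` file (theorems only) in topic `NumberTheory/EllipticCurves`, continuing
`ArtinFormalismAbelianEulerProofs` (the local Artin identity
`∏_{w ∣ v} L_w(E_F, N w^{-s})⁻¹ = ∏_{χ ∈ X(F)} χ⋆ • L_v(E, N v^{-s})⁻¹` at a place `v` where `E` is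
SEMISTABLE) to the places `v` where `E` is possibly additive but a quadratic twist
`E' = E^{(D)}` (`W.quadraticTwist D`) is semistable, under the hypothesis that `√D` lies in the
cyclotomic field `L = ℚ(ζ_m) ⊇ F`.  The result
(`WeierstrassCurve.intCoe_finprod_localEulerFactor_baseChange_eq_prod_primitiveTwist_of_quadraticTwist`)
is the identity of formal Dirichlet series supported on the powers of `p = N v`

  `∏_{w ∣ v} L_w(E_F, N w^{-s})⁻¹ = ∏_{χ ∈ X(F)} (χψ_D)⋆ • L_v(E^{(D)}, N v^{-s})⁻¹`,

where `ψ_D ∈ X(L)` is the quadratic Dirichlet character mod `m` cutting out `ℚ(√D) ⊆ L`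
(`exists_dirichletCharacter_sqrt`: `ψ_D(σ) = ±1` according as `σ√D = ±√D`) and `(χψ_D)⋆` is the
primitive character inducing `χψ_D`.  It is the exact local Artin formalism at such a place:
`(V_ℓ(E) ⊗ χ)_{I_p} = (V_ℓ(E^{(D)}) ⊗ χψ_D)_{I_p}` is non-zero exactly when `χψ_D` is unramified at
`p`, where it is the naive `(χψ_D)⋆(p)`-twist of the Euler factor of the semistable curve
`E^{(D)}`.

Proof (no new case analysis): let `F' = F(√D) ⊆ L`.  Over `F'` the curves `E` and `E^{(D)}` are
isomorphic, so their Euler factors at the places of `F'` agree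
(`localEulerFactor_baseChange_eq_of_sq_eq`); the relative quadratic Artin formalism for `F'/F`
(`finprod_localEulerFactor_baseChange_relQuadratic`, applied to `E_F` and its twist
`(E_F)^{(D)} = (E^{(D)})_F`) gives, above `v`,
`(∏_{w ∣ v} L_w(E_F)⁻¹)(∏_{w ∣ v} L_w(E^{(D)}_F)⁻¹) = ∏_{w' ∣ v} L_{w'}(E^{(D)}_{F'})⁻¹`; the two
products attached to the SEMISTABLE curve `E^{(D)}` are given by the local Artin identity of
`ArtinFormalismAbelianEulerProofs` over `F` and over `F'`, and the character group of `F'` is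
`X(F') = X(F) ⊔ ψ_D X(F)` (`characterGroup_adjoin_sqrt`); cancelling the invertible factor
`∏_{w ∣ v} L_w(E^{(D)}_F)⁻¹ = ∏_{χ ∈ X(F)} χ⋆ • L_v(E^{(D)})⁻¹` leaves the claim.  (If `√D ∈ F` the
identity is that of `ArtinFormalismAbelianEulerProofs` for `E^{(D)} ≅_F E`, reindexed by
`χ ↦ χψ_D`.)

## References

* K. Ireland, M. Rosen, *A Classical Introduction to Modern Number Theory*, 2nd ed. (1990),
  Ch. 20 §5, Prop. 20.5.4 (b). [IrelandRosen1990]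
* D. E. Rohrlich, *Modular curves, Hecke correspondences, and L-functions*, in: Modular Forms and
  Fermat's Last Theorem (1997), §3.9. [Rohrlich1997]
* J. H. Silverman, *The Arithmetic of Elliptic Curves*, 2nd ed. (2009), X.5 Cor. 5.4, §C.16.
  [SilvermanAEC2009]
-/

noncomputable section

open scoped Classical NumberField
open IsDedekindDomain NumberField Polynomial IntermediateField

namespace WeierstrassCurve

open ArithmeticFunction Literature.NumberTheory.EllipticCurves
  Literature.NumberTheory.GaloisRepresentations IsCyclotomicExtension.Rat

/-! ## The quadratic Dirichlet character of `√D ∈ ℚ(ζ_m)` -/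

section Character

variable {m : ℕ} [NeZero m] (L : Type) [Field L] [NumberField L]
  [hL : IsCyclotomicExtension {m} ℚ L]

/-- An automorphism sends a square root `θ` of a rational number to `±θ`. [folklore] -/
theorem _root_.Literature.NumberTheory.EllipticCurves.apply_sqrt_eq_or_eq_neg {D : ℚ} {θ : L}
    (hθ : θ ^ 2 = algebraMap ℚ L D) (σ : L ≃ₐ[ℚ] L) : σ θ = θ ∨ σ θ = -θ := by
  apply sq_eq_sq_iff_eq_or_eq_neg.mp
  rw [← map_pow, hθ, AlgEquiv.commutes]

/-- A non-zero square root `θ` (of `D ≠ 0`) is not `-θ` (characteristic `0`). [folklore] -/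
theorem _root_.Literature.NumberTheory.EllipticCurves.sqrt_ne_neg {D : ℚ} (hD0 : D ≠ 0) {θ : L}
    (hθ : θ ^ 2 = algebraMap ℚ L D) : θ ≠ -θ := by
  have hθ0 : θ ≠ 0 := by
    intro h
    apply hD0
    have h' : algebraMap ℚ L D = 0 := by rw [← hθ, h]; ring
    exact (map_eq_zero _).mp h'
  intro h
  exact hθ0 (add_self_eq_zero.mp (eq_neg_iff_add_eq_zero.mp h))

include hL in
/-- **The quadratic Dirichlet character of `√D ∈ ℚ(ζ_m)`.**  For `θ ∈ L = ℚ(ζ_m)` with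
`θ² = D ∈ ℚˣ` there is a Dirichlet character `ψ` mod `m` (over `ℂ`) with, for every
`σ ∈ Gal(L/ℚ) ≅ (ℤ/m)ˣ` (Mathlib `galEquivZMod`), `ψ(σ) = 1` if `σθ = θ` and `ψ(σ) = -1` if
`σθ = -θ`: the character of `Gal(L/ℚ)` cutting out `ℚ(√D) ⊆ L`, read as a Dirichlet character.
(Washington, *Introduction to Cyclotomic Fields*, Ch. 3, characters of `Gal(ℚ(ζ_m)/ℚ)`.)
[folklore] -/
theorem exists_dirichletCharacter_sqrt {D : ℚ} (hD0 : D ≠ 0) {θ : L}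
    (hθ : θ ^ 2 = algebraMap ℚ L D) :
    ∃ ψ : DirichletCharacter ℂ m,
      (∀ σ : L ≃ₐ[ℚ] L, σ θ = θ → ψ (galEquivZMod m L σ) = 1) ∧
      (∀ σ : L ≃ₐ[ℚ] L, σ θ = -θ → ψ (galEquivZMod m L σ) = -1) := by
  have hne := sqrt_ne_neg L hD0 hθ
  have hne' : -θ ≠ θ := fun h ↦ hne h.symm
  let s : (L ≃ₐ[ℚ] L) → ℂˣ := fun σ ↦ if σ θ = θ then 1 else -1
  have hs1 : ∀ σ, σ θ = θ → s σ = 1 := fun σ h ↦ if_pos h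
  have hs2 : ∀ σ, σ θ = -θ → s σ = -1 := fun σ h ↦ by
    have h' : ¬ σ θ = θ := by rw [h]; exact hne'
    exact if_neg h'
  let sh : (L ≃ₐ[ℚ] L) →* ℂˣ :=
    { toFun := s
      map_one' := hs1 1 rfl
      map_mul' := fun σ τ ↦ by
        change s (σ * τ) = s σ * s τ
        rcases apply_sqrt_eq_or_eq_neg L hθ τ with hτ | hτ <;>
          rcases apply_sqrt_eq_or_eq_neg L hθ σ with hσ | hσ
        · rw [hs1 τ hτ, hs1 σ hσ, mul_one, hs1 _ (by rw [AlgEquiv.mul_apply, hτ, hσ])]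
        · rw [hs1 τ hτ, hs2 σ hσ, mul_one, hs2 _ (by rw [AlgEquiv.mul_apply, hτ, hσ])]
        · rw [hs2 τ hτ, hs1 σ hσ, one_mul, hs2 _ (by rw [AlgEquiv.mul_apply, hτ, map_neg, hσ])]
        · rw [hs2 τ hτ, hs2 σ hσ, neg_mul_neg, one_mul,
            hs1 _ (by rw [AlgEquiv.mul_apply, hτ, map_neg, hσ, neg_neg])] }
  refine ⟨MulChar.ofUnitHom (sh.comp (galEquivZMod m L).symm.toMonoidHom), fun σ h ↦ ?_,
    fun σ h ↦ ?_⟩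
  · rw [MulChar.ofUnitHom_coe, MonoidHom.comp_apply, MulEquiv.coe_toMonoidHom,
      MulEquiv.symm_apply_apply]
    change ((s σ : ℂˣ) : ℂ) = 1
    rw [hs1 σ h, Units.val_one]
  · rw [MulChar.ofUnitHom_coe, MonoidHom.comp_apply, MulEquiv.coe_toMonoidHom,
      MulEquiv.symm_apply_apply]
    change ((s σ : ℂˣ) : ℂ) = -1
    rw [hs2 σ h, Units.val_neg, Units.val_one]

end Character

/-! ## The character group of `F(√D)` -/

section Subfield

variable (L : Type) [Field L] [NumberField L] (F : IntermediateField ℚ L)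

/-- An automorphism fixes `ℚ(θ)` pointwise iff it fixes `θ`. [folklore] -/
theorem _root_.Literature.NumberTheory.EllipticCurves.mem_fixingSubgroup_adjoin_simple_iff
    (θ : L) (σ : L ≃ₐ[ℚ] L) :
    σ ∈ (IntermediateField.adjoin ℚ ({θ} : Set L)).fixingSubgroup ↔ σ θ = θ := by
  constructor
  · intro h
    rw [IntermediateField.mem_fixingSubgroup_iff] at h
    exact h θ (IntermediateField.mem_adjoin_simple_self ℚ θ)
  · intro h
    have hle : IntermediateField.adjoin ℚ ({θ} : Set L) ≤
        IntermediateField.fixedField (Subgroup.zpowers σ) := by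
      rw [IntermediateField.adjoin_simple_le_iff, IntermediateField.mem_fixedField_iff]
      intro τ hτ
      obtain ⟨k, rfl⟩ := Subgroup.mem_zpowers_iff.mp hτ
      exact MulAction.mem_fixedBy_zpow (α := L) (g := σ) h k
    rw [IntermediateField.mem_fixingSubgroup_iff]
    intro x hx
    exact (IntermediateField.mem_fixedField_iff (Subgroup.zpowers σ) x).mp (hle hx) σ
      (Subgroup.mem_zpowers σ)

/-- **The stabiliser of `F(θ)`**: `σ` fixes `F(θ) = F ⊔ ℚ(θ)` pointwise iff it fixes `F`
pointwise and fixes `θ` (Mathlib `fixingSubgroup_sup`, `restrictScalars_adjoin_eq_sup`).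
[folklore] -/
theorem _root_.Literature.NumberTheory.EllipticCurves.mem_fixingSubgroup_adjoin_iff (θ : L)
    (σ : L ≃ₐ[ℚ] L) :
    σ ∈ ((IntermediateField.adjoin F ({θ} : Set L)).restrictScalars ℚ).fixingSubgroup ↔
      σ ∈ F.fixingSubgroup ∧ σ θ = θ := by
  rw [show (IntermediateField.adjoin F ({θ} : Set L)).restrictScalars ℚ =
      F ⊔ IntermediateField.adjoin ℚ ({θ} : Set L) from
        IntermediateField.restrictScalars_adjoin_eq_sup (F := ℚ) F ({θ} : Set L),
    IntermediateField.fixingSubgroup_sup, Subgroup.mem_inf, mem_fixingSubgroup_adjoin_simple_iff]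

/-- **`[F(√D) : F] = 2` for `√D ∉ F`**: the minimal polynomial of `θ` over `F` divides `X² - D`
and is not linear. [folklore] -/
theorem _root_.Literature.NumberTheory.EllipticCurves.finrank_adjoin_sqrt_eq_two {D : ℚ} {θ : L}
    (hθ : θ ^ 2 = algebraMap ℚ L D) (hθF : θ ∉ F) :
    Module.finrank F (IntermediateField.adjoin F ({θ} : Set L)) = 2 := by
  have hint : _root_.IsIntegral F θ := (Algebra.IsIntegral.isIntegral (R := ℚ) θ).tower_top
  rw [IntermediateField.adjoin.finrank hint]
  set d : F := algebraMap ℚ F D with hd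
  have hroot : Polynomial.aeval θ (X ^ 2 - C d : F[X]) = 0 := by
    simp only [map_sub, map_pow, aeval_X, aeval_C, hθ, hd]
    rw [← IsScalarTower.algebraMap_apply, sub_self]
  have hdvd : minpoly F θ ∣ X ^ 2 - C d := minpoly.dvd F θ hroot
  have hmonic : (X ^ 2 - C d : F[X]).Monic := monic_X_pow_sub_C d two_ne_zero
  have hdeg2 : (X ^ 2 - C d : F[X]).natDegree = 2 := natDegree_X_pow_sub_C
  have hle : (minpoly F θ).natDegree ≤ 2 := by
    rw [← hdeg2]
    exact natDegree_le_of_dvd hdvd hmonic.ne_zero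
  have hne1 : (minpoly F θ).natDegree ≠ 1 := by
    intro h1
    apply hθF
    obtain ⟨x, hx⟩ := (minpoly.natDegree_eq_one_iff).mp h1
    rw [← hx]
    exact x.2
  have hpos : 0 < (minpoly F θ).natDegree := minpoly.natDegree_pos hint
  omega

end Subfield

section CharacterGroup

variable {m : ℕ} [NeZero m] (L : Type) [Field L] [NumberField L]
  [hL : IsCyclotomicExtension {m} ℚ L] (F : IntermediateField ℚ L)

include hL in
/-- **`X(F(√D)) = X(F) ⊔ ψ_D · X(F)`.**  With `X(E) = {χ mod m : χ(σ) = 1 ∀ σ ∈ Gal(L/E)}` the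
character group of an intermediate field `E` of `L = ℚ(ζ_m)` and `ψ_D` the quadratic character of
`√D = θ ∈ L` (`exists_dirichletCharacter_sqrt`): the character group of `F(θ)` is the union of
`X(F)` and its translate `X(F) ψ_D` — a character trivial on `Gal(L/F(θ)) = Gal(L/F) ∩ Stab(θ)`
restricts to `Gal(L/F)` either trivially or as `ψ_D` — and the union is disjoint when `θ ∉ F`.
(Washington, *Introduction to Cyclotomic Fields*, Thm. 3.7 / §3, duality between subfields of
`ℚ(ζ_m)` and groups of Dirichlet characters.) [folklore] -/
theorem _root_.Literature.NumberTheory.EllipticCurves.characterGroup_adjoin_sqrt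
    {D : ℚ} {θ : L} (hθ : θ ^ 2 = algebraMap ℚ L D)
    (ψ : DirichletCharacter ℂ m)
    (hψ1 : ∀ σ : L ≃ₐ[ℚ] L, σ θ = θ → ψ (galEquivZMod m L σ) = 1)
    (hψ2 : ∀ σ : L ≃ₐ[ℚ] L, σ θ = -θ → ψ (galEquivZMod m L σ) = -1) :
    (({χ | ∀ σ ∈ ((IntermediateField.adjoin F ({θ} : Set L)).restrictScalars ℚ).fixingSubgroup,
        χ (galEquivZMod m L σ) = 1} : Finset (DirichletCharacter ℂ m)) =
      ({χ | ∀ σ ∈ F.fixingSubgroup, χ (galEquivZMod m L σ) = 1} : Finset (DirichletCharacter ℂ m)) ∪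
        ({χ | ∀ σ ∈ F.fixingSubgroup, χ (galEquivZMod m L σ) = 1} :
          Finset (DirichletCharacter ℂ m)).image (· * ψ)) ∧
    (θ ∉ F → Disjoint
      ({χ | ∀ σ ∈ F.fixingSubgroup, χ (galEquivZMod m L σ) = 1} : Finset (DirichletCharacter ℂ m))
      (({χ | ∀ σ ∈ F.fixingSubgroup, χ (galEquivZMod m L σ) = 1} :
          Finset (DirichletCharacter ℂ m)).image (· * ψ))) := by
  have hdich := apply_sqrt_eq_or_eq_neg L hθ
  have hmulval : ∀ (χ : DirichletCharacter ℂ m) (σ : L ≃ₐ[ℚ] L),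
      (χ * ψ) (galEquivZMod m L σ) = χ (galEquivZMod m L σ) * ψ (galEquivZMod m L σ) :=
    fun χ σ ↦ MulChar.mul_apply χ ψ _
  have hψsq : ∀ σ : L ≃ₐ[ℚ] L, ψ (galEquivZMod m L σ) * ψ (galEquivZMod m L σ) = 1 := by
    intro σ
    rcases hdich σ with h | h
    · rw [hψ1 σ h, mul_one]
    · rw [hψ2 σ h]; norm_num
  -- `ψ² = 1`: `ψ` takes the values `±1` on all units (`galEquivZMod` is onto)
  have hψψ : ψ * ψ = 1 := by
    apply MulChar.ext
    intro u
    obtain ⟨σ, rfl⟩ := (galEquivZMod m L).surjective u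
    rw [MulChar.mul_apply, MulChar.one_apply_coe, hψsq]
  set XF : Finset (DirichletCharacter ℂ m) :=
    {χ | ∀ σ ∈ F.fixingSubgroup, χ (galEquivZMod m L σ) = 1} with hXF
  have hmemXF : ∀ χ, χ ∈ XF ↔ ∀ σ ∈ F.fixingSubgroup, χ (galEquivZMod m L σ) = 1 := fun χ ↦ by
    rw [hXF, Finset.mem_filter]
    simp
  have hmemX' : ∀ χ : DirichletCharacter ℂ m,
      χ ∈ ({χ | ∀ σ ∈ ((IntermediateField.adjoin F ({θ} : Set L)).restrictScalars ℚ).fixingSubgroup,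
        χ (galEquivZMod m L σ) = 1} : Finset (DirichletCharacter ℂ m)) ↔
      ∀ σ ∈ F.fixingSubgroup, σ θ = θ → χ (galEquivZMod m L σ) = 1 := by
    intro χ
    rw [Finset.mem_filter]
    simp only [Finset.mem_univ, true_and, mem_fixingSubgroup_adjoin_iff]
    exact ⟨fun h σ hσ hθσ ↦ h σ ⟨hσ, hθσ⟩, fun h σ hσ ↦ h σ hσ.1 hσ.2⟩
  have hmemimg : ∀ χ : DirichletCharacter ℂ m, χ ∈ XF.image (· * ψ) ↔ χ * ψ ∈ XF := by
    intro χ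
    rw [Finset.mem_image]
    constructor
    · rintro ⟨χ₀, hχ₀, rfl⟩
      rw [hmemXF] at hχ₀ ⊢
      intro σ hσ
      rw [hmulval, hmulval, mul_assoc, hψsq, mul_one, hχ₀ σ hσ]
    · intro h
      exact ⟨χ * ψ, h, by rw [mul_assoc, hψψ, mul_one]⟩
  refine ⟨?_, fun hθF ↦ ?_⟩
  · ext χ
    rw [hmemX', Finset.mem_union, hmemXF, hmemimg, hmemXF]
    constructor
    · intro h
      by_cases hall : ∀ σ ∈ F.fixingSubgroup, χ (galEquivZMod m L σ) = 1
      · exact Or.inl hall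
      · right
        push Not at hall
        obtain ⟨σ₀, hσ₀, hχσ₀⟩ := hall
        have hσ₀θ : σ₀ θ = -θ := by
          rcases hdich σ₀ with h' | h'
          · exact absurd (h σ₀ hσ₀ h') hχσ₀
          · exact h'
        -- `χ(σ₀)² = χ(σ₀²) = 1` (as `σ₀² θ = θ`), so `χ(σ₀) = -1`
        have hsq : χ (galEquivZMod m L σ₀) * χ (galEquivZMod m L σ₀) = 1 := by
          rw [← map_mul χ, ← Units.val_mul, ← map_mul]
          exact h _ (F.fixingSubgroup.mul_mem hσ₀ hσ₀)
            (by rw [AlgEquiv.mul_apply, hσ₀θ, map_neg, hσ₀θ, neg_neg])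
        have hχσ₀' : χ (galEquivZMod m L σ₀) = -1 := by
          have h3 := mul_self_eq_one_iff.mp hsq
          exact h3.resolve_left hχσ₀
        intro σ hσ
        rw [hmulval]
        rcases hdich σ with hσθ | hσθ
        · rw [h σ hσ hσθ, hψ1 σ hσθ, mul_one]
        · -- `σ₀ σ` fixes `θ`, so `χ(σ₀) χ(σ) = 1`
          have hfix : (σ₀ * σ) θ = θ := by rw [AlgEquiv.mul_apply, hσθ, map_neg, hσ₀θ, neg_neg]
          have h1 := h _ (F.fixingSubgroup.mul_mem hσ₀ hσ) hfix
          rw [map_mul, Units.val_mul, map_mul, hχσ₀'] at h1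
          rw [hψ2 σ hσθ]
          linear_combination h1
    · rintro (h | h)
      · exact fun σ hσ _ ↦ h σ hσ
      · intro σ hσ hσθ
        have h1 := h σ hσ
        rw [hmulval, hψ1 σ hσθ, mul_one] at h1
        exact h1
  · rw [Finset.disjoint_left]
    intro χ hχ hχ'
    rw [hmemimg] at hχ'
    rw [hmemXF] at hχ hχ'
    -- then `ψ` is trivial on `Gal(L/F)`, so `θ ∈ F`
    apply hθF
    have hψH : ∀ σ ∈ F.fixingSubgroup, σ θ = θ := by
      intro σ hσ
      have h1 := hχ' σ hσ
      rw [hmulval, hχ σ hσ, one_mul] at h1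
      rcases hdich σ with h' | h'
      · exact h'
      · rw [hψ2 σ h'] at h1
        norm_num at h1
    haveI : IsGalois ℚ L := IsCyclotomicExtension.isGalois {m} ℚ L
    have hmem : θ ∈ IntermediateField.fixedField F.fixingSubgroup := fun σ ↦ hψH σ σ.2
    rwa [IsGalois.fixedField_fixingSubgroup] at hmem

end CharacterGroup

/-! ## Over a field containing `√D`, `E` and `E^{(D)}` have the same Euler factors -/

section Iso

variable (W : WeierstrassCurve ℚ) [W.IsElliptic] (K : Type) [Field K] [NumberField K]

/-- **`E ≅ E^{(D)}` over `K ∋ √D`, Euler factor by Euler factor.**  If `θ ∈ K` with `θ² = D ≠ 0`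
then `(E^{(D)})_K = (E_K)^{(θ²)} = C • E_K` for a change of variables `C` over `K`
(`map_quadraticTwist`, `exists_variableChange_smul_eq_quadraticTwist_sq`), so the local Euler
factors of `E_K` and `(E^{(D)})_K` agree at every place of `K` (`localEulerFactor_smul`).
Silverman, *AEC* X.5 Cor. 5.4 (iii) with §C.16. [cite: SilvermanAEC2009, X.5 Cor. 5.4] -/
theorem localEulerFactor_baseChange_eq_of_sq_eq {D : ℚ} (hD0 : D ≠ 0) {θ : K}
    (hθ : θ ^ 2 = algebraMap ℚ K D) (w : HeightOneSpectrum (𝓞 K)) :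
    (((W.quadraticTwist D).baseChange K).baseChange (w.adicCompletion K)).localEulerFactor
        (w.adicCompletionIntegers K) =
      ((W.baseChange K).baseChange (w.adicCompletion K)).localEulerFactor
        (w.adicCompletionIntegers K) := by
  haveI : (W.baseChange K).IsElliptic := by rw [baseChange]; infer_instance
  have hθ0 : θ ≠ 0 := by
    intro h
    apply hD0
    have h' : algebraMap ℚ K D = 0 := by rw [← hθ, h]; ring
    exact (map_eq_zero _).mp h'
  obtain ⟨C, hC⟩ := (W.baseChange K).exists_variableChange_smul_eq_quadraticTwist_sq hθ0
  have htw : (W.quadraticTwist D).baseChange K = C • W.baseChange K := by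
    rw [hC, hθ, baseChange, map_quadraticTwist]
    rfl
  rw [htw, baseChange, baseChange, ← map_variableChange]
  exact localEulerFactor_smul _ _ _

end Iso

/-! ## The local Artin identity above a place of semistable reduction of `E^{(D)}` -/

section LocalIdentity

variable (W : WeierstrassCurve ℚ) [W.IsElliptic] {m : ℕ} [NeZero m] (L : Type) [Field L]
  [NumberField L] [hL : IsCyclotomicExtension {m} ℚ L] (F : IntermediateField ℚ L)

/-- At any finite place `w`, the local Euler factor times the local polynomial (both as Dirichlet
series in `N w^{-s}`) is `1` (private copy of the `ArtinFormalismAbelianEulerProofs` lemma).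
[folklore] -/
private theorem localEulerFactor_mul_ofPowerSeries' {K : Type*} [Field K] [NumberField K]
    (X' : WeierstrassCurve K) (w : HeightOneSpectrum (𝓞 K)) :
    (X'.baseChange (w.adicCompletion K)).localEulerFactor (w.adicCompletionIntegers K) *
      ofPowerSeries w.residueCard ((X'.localPolynomialAt w : ℤ[X]) : PowerSeries ℤ) = 1 := by
  rw [X'.localEulerFactor_baseChange_adicCompletion w, ← map_mul, mul_comm,
    PowerSeries.mul_invOfUnit _ 1 (by rw [Polynomial.constantCoeff_coe,
      X'.coeff_zero_localPolynomialAt w, Units.val_one]), map_one]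

/-- A finite product of arithmetic functions over `ℤ`, coerced to `ℂ` (private copy). [folklore] -/
private theorem intCoe_finset_prod' {α : Type*} (s : Finset α) (f : α → ArithmeticFunction ℤ) :
    ((∏ a ∈ s, f a : ArithmeticFunction ℤ) : ArithmeticFunction ℂ) = ∏ a ∈ s, (f a : ArithmeticFunction ℂ) := by
  induction s using Finset.induction_on with
  | empty => simp
  | insert a s ha ih => rw [Finset.prod_insert ha, Finset.prod_insert ha, intCoe_mul, ih]

include hL in
set_option maxHeartbeats 1600000 in
/-- **The local Artin identity at a place where a quadratic twist is semistable.**  Let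
`L ⊇ ℚ` be an `m`-th cyclotomic field, `F ⊆ L` with character group `X(F)`, `E/ℚ` an elliptic
curve, `D ∈ ℚˣ` with a square root `θ ∈ L`, `ψ = ψ_D` its quadratic Dirichlet character mod `m`
(`exists_dirichletCharacter_sqrt`), and `v` a finite place of `ℚ` (`p = N v`) at which the twist
`E^{(D)}` is semistable.  Then
`∏_{w ∣ v} L_w(E_F, N w^{-s})⁻¹ = ∏_{χ ∈ X(F)} (χψ)⋆ • L_v(E^{(D)}, N v^{-s})⁻¹`
as formal Dirichlet series over `ℂ`, `(χψ)⋆` the primitive character inducing `χψ`: the exact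
local Artin formalism at `v` for the (possibly additive) curve `E`, through its semistable twist.
See the module docstring for the proof (relative quadratic Artin formalism for `F(θ)/F`, the
identity of `ArtinFormalismAbelianEulerProofs` for `E^{(D)}` over `F` and over `F(θ)`, and
`X(F(θ)) = X(F) ⊔ ψ X(F)`).  (Ireland–Rosen Prop. 20.5.4 (b); Rohrlich 1997 §3.9 for the twisted
Euler factors.) [cite: IrelandRosen1990, Ch. 20 §5, Prop. 20.5.4(b) (PDF p. 353)] -/
theorem intCoe_finprod_localEulerFactor_baseChange_eq_prod_primitiveTwist_of_quadraticTwist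
    {D : ℚ} (hD0 : D ≠ 0) {θ : L} (hθ : θ ^ 2 = algebraMap ℚ L D)
    (ψ : DirichletCharacter ℂ m)
    (hψ1 : ∀ σ : L ≃ₐ[ℚ] L, σ θ = θ → ψ (galEquivZMod m L σ) = 1)
    (hψ2 : ∀ σ : L ≃ₐ[ℚ] L, σ θ = -θ → ψ (galEquivZMod m L σ) = -1)
    (v : HeightOneSpectrum (𝓞 ℚ)) (hv : (W.quadraticTwist D).IsSemistableAt v) :
    ((∏ᶠ w ∈ {w : HeightOneSpectrum (𝓞 F) | w.under (𝓞 ℚ) = v},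
        (((W.baseChange F).baseChange (w.adicCompletion F)).localEulerFactor
          (w.adicCompletionIntegers F) : ArithmeticFunction ℤ) : ArithmeticFunction ℤ) :
        ArithmeticFunction ℂ) =
      ∏ χ ∈ ({χ | ∀ σ ∈ F.fixingSubgroup, χ (galEquivZMod m L σ) = 1} :
          Finset (DirichletCharacter ℂ m)),
        (toArithmeticFunction fun k : ℕ ↦
            (χ * ψ).primitiveCharacter (k : ZMod (χ * ψ).conductor)).pmul
          ((((W.quadraticTwist D).baseChange (v.adicCompletion ℚ)).localEulerFactor
            (v.adicCompletionIntegers ℚ) : ArithmeticFunction ℤ) : ArithmeticFunction ℂ) := by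
  haveI hEd : (W.quadraticTwist D).IsElliptic := W.isElliptic_quadraticTwist hD0
  haveI : (W.baseChange F).IsElliptic := by rw [baseChange]; infer_instance
  set W' := W.quadraticTwist D with hW'
  set XF : Finset (DirichletCharacter ℂ m) :=
    {χ | ∀ σ ∈ F.fixingSubgroup, χ (galEquivZMod m L σ) = 1} with hXF
  have hmemXF : ∀ χ, χ ∈ XF ↔ ∀ σ ∈ F.fixingSubgroup, χ (galEquivZMod m L σ) = 1 := fun χ ↦ by
    rw [hXF, Finset.mem_filter]
    simp
  -- `ψ² = 1`
  have hdich := apply_sqrt_eq_or_eq_neg L hθ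
  have hψsq : ∀ σ : L ≃ₐ[ℚ] L, ψ (galEquivZMod m L σ) * ψ (galEquivZMod m L σ) = 1 := by
    intro σ
    rcases hdich σ with h | h
    · rw [hψ1 σ h, mul_one]
    · rw [hψ2 σ h]; norm_num
  have hψψ : ψ * ψ = 1 := by
    apply MulChar.ext
    intro u
    obtain ⟨σ, rfl⟩ := (galEquivZMod m L).surjective u
    rw [MulChar.mul_apply, MulChar.one_apply_coe, hψsq]
  -- the local Artin identity for the semistable curve `W'` over `F`
  have hB := W'.intCoe_finprod_localEulerFactor_baseChange_eq_prod_primitiveTwist (m := m) L F v hv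
  have hT : {w : HeightOneSpectrum (𝓞 F) | w.under (𝓞 ℚ) = v}.Finite :=
    v.finite_setOf_under_eq_of_numberField
  by_cases hθF : θ ∈ F
  · /- ### `√D ∈ F`: `E_F ≅ E'_F`, `ψ ∈ X(F)`, reindex by `χ ↦ χψ` -/
    set θF : F := ⟨θ, hθF⟩ with hθFdef
    have hθF2 : θF ^ 2 = algebraMap ℚ F D := by
      apply Subtype.ext
      change θ ^ 2 = ((algebraMap ℚ F D : F) : L)
      rw [hθ]
      rfl
    have hiso : ∀ w : HeightOneSpectrum (𝓞 F),
        ((W'.baseChange F).baseChange (w.adicCompletion F)).localEulerFactor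
            (w.adicCompletionIntegers F) =
          ((W.baseChange F).baseChange (w.adicCompletion F)).localEulerFactor
            (w.adicCompletionIntegers F) :=
      fun w ↦ W.localEulerFactor_baseChange_eq_of_sq_eq F hD0 hθF2 w
    have hψX : ψ ∈ XF := by
      rw [hmemXF]
      intro σ hσ
      exact hψ1 σ ((IntermediateField.mem_fixingSubgroup_iff _ _).mp hσ θ hθF)
    rw [show (∏ᶠ w ∈ {w : HeightOneSpectrum (𝓞 F) | w.under (𝓞 ℚ) = v},
        ((W.baseChange F).baseChange (w.adicCompletion F)).localEulerFactor
          (w.adicCompletionIntegers F)) =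
        ∏ᶠ w ∈ {w : HeightOneSpectrum (𝓞 F) | w.under (𝓞 ℚ) = v},
          ((W'.baseChange F).baseChange (w.adicCompletion F)).localEulerFactor
            (w.adicCompletionIntegers F) from finprod_mem_congr rfl fun w _ ↦ (hiso w).symm, hB]
    -- reindex: `χ ↦ χ * ψ` is a bijection of `X(F)` (`ψ ∈ X(F)`, `ψ² = 1`)
    have hclosed : ∀ χ ∈ XF, χ * ψ ∈ XF := by
      intro χ hχ
      rw [hmemXF] at hχ ⊢
      intro σ hσ
      rw [MulChar.mul_apply, hχ σ hσ, (hmemXF ψ).mp hψX σ hσ, mul_one]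
    symm
    refine Finset.prod_nbij (fun χ ↦ χ * ψ) (fun χ hχ ↦ ?_) (fun χ₁ _ χ₂ _ h ↦ ?_)
      (fun χ hχ ↦ ?_) (fun χ _ ↦ rfl)
    · exact hclosed χ hχ
    · exact mul_right_cancel h
    · have hχ' : χ ∈ XF := by rw [hXF]; exact Finset.mem_coe.mp hχ
      exact ⟨χ * ψ, Finset.mem_coe.mpr (hclosed χ hχ'), by
        change χ * ψ * ψ = χ
        rw [mul_assoc, hψψ, mul_one]⟩
  · /- ### `√D ∉ F`: the quadratic extension `F' = F(θ)` -/
    set F' : IntermediateField ℚ L :=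
      (IntermediateField.adjoin F ({θ} : Set L)).restrictScalars ℚ with hF'def
    letI : Algebra F F' := (IntermediateField.adjoin F ({θ} : Set L)).algebra
    haveI : IsScalarTower ℚ F F' := IsScalarTower.of_algebraMap_eq (fun x ↦ rfl)
    haveI : IsScalarTower F F' L := IntermediateField.isScalarTower_mid _
    haveI : (W.baseChange F').IsElliptic := by rw [baseChange]; infer_instance
    have h2 : Module.finrank F F' = 2 := finrank_adjoin_sqrt_eq_two L F hθ hθF
    haveI : Module.Free F F' := Module.Free.of_divisionRing F F'
    haveI : FiniteDimensional F F' := Module.finite_of_finrank_pos (by rw [h2]; exact two_pos)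
    -- `θ` as an element of `F'`, a square root of `D` over `F`, not in `F`
    set θ' : F' := ⟨θ, IntermediateField.mem_adjoin_simple_self F θ⟩ with hθ'def
    have hθ'2 : θ' ^ 2 = algebraMap F F' (algebraMap ℚ F D) := by
      apply Subtype.ext
      change θ ^ 2 = ((algebraMap ℚ F D : F) : L)
      rw [hθ]
      rfl
    have hθ'F : θ' ∉ Set.range (algebraMap F F') := by
      rintro ⟨x, hx⟩
      apply hθF
      have hx' : ((x : F) : L) = θ := congrArg Subtype.val hx
      rw [← hx']
      exact x.2
    have hθ'2' : (θ' : F') ^ 2 = algebraMap ℚ F' D := by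
      rw [hθ'2, ← IsScalarTower.algebraMap_apply]
    have hDF0 : algebraMap ℚ F D ≠ 0 := (_root_.map_ne_zero _).mpr hD0
    -- base changes: `(E_F)_{F'} = E_{F'}`, `(E_F)^{(D)} = (E^{(D)})_F`
    have hbc : (W.baseChange F).baseChange F' = W.baseChange F' := by
      rw [baseChange, baseChange, baseChange, map_map, ← IsScalarTower.algebraMap_eq]
    have htwF : (W.baseChange F).quadraticTwist (algebraMap ℚ F D) = W'.baseChange F := by
      rw [hW', baseChange, baseChange, map_quadraticTwist]
    /- ### The relative quadratic Artin formalism above each `w ∣ v`, multiplied over `w` -/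
    have hQ1 : ∀ w : HeightOneSpectrum (𝓞 F),
        ∏ᶠ w' ∈ {w' : HeightOneSpectrum (𝓞 F') | w'.under (𝓞 F) = w},
            ((W'.baseChange F').baseChange (w'.adicCompletion F')).localEulerFactor
              (w'.adicCompletionIntegers F') =
          ((W.baseChange F).baseChange (w.adicCompletion F)).localEulerFactor
              (w.adicCompletionIntegers F) *
            ((W'.baseChange F).baseChange (w.adicCompletion F)).localEulerFactor
              (w.adicCompletionIntegers F) := by
      intro w
      have h := (W.baseChange F).finprod_localEulerFactor_baseChange_relQuadratic F' h2 hDF0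
        hθ'2 hθ'F w
      rw [hbc, htwF] at h
      rw [← h]
      exact finprod_mem_congr rfl fun w' _ ↦ W.localEulerFactor_baseChange_eq_of_sq_eq F' hD0
        hθ'2' w'
    -- the places of `F'` above `v`, grouped by the places of `F`
    have hT' : {w' : HeightOneSpectrum (𝓞 F') | w'.under (𝓞 ℚ) = v} =
        ⋃ w ∈ {w : HeightOneSpectrum (𝓞 F) | w.under (𝓞 ℚ) = v},
          {w' : HeightOneSpectrum (𝓞 F') | w'.under (𝓞 F) = w} := by
      ext w'
      simp only [Set.mem_setOf_eq, Set.mem_iUnion, exists_prop]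
      constructor
      · intro h
        refine ⟨w'.under (𝓞 F), ?_, rfl⟩
        rw [← h]
        exact HeightOneSpectrum.ext (Ideal.under_under (A := 𝓞 ℚ) (B := 𝓞 F) w'.asIdeal)
      · rintro ⟨w, hw, rfl⟩
        rw [← hw]
        exact (HeightOneSpectrum.ext (Ideal.under_under (A := 𝓞 ℚ) (B := 𝓞 F) w'.asIdeal)).symm
    have hdisj : {w : HeightOneSpectrum (𝓞 F) | w.under (𝓞 ℚ) = v}.PairwiseDisjoint
        fun w ↦ {w' : HeightOneSpectrum (𝓞 F') | w'.under (𝓞 F) = w} := by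
      intro w₁ _ w₂ _ hne
      rw [Function.onFun, Set.disjoint_left]
      intro w' h1 h2
      exact hne (h1.symm.trans h2)
    have hC : ∏ᶠ w' ∈ {w' : HeightOneSpectrum (𝓞 F') | w'.under (𝓞 ℚ) = v},
        ((W'.baseChange F').baseChange (w'.adicCompletion F')).localEulerFactor
          (w'.adicCompletionIntegers F') =
        (∏ᶠ w ∈ {w : HeightOneSpectrum (𝓞 F) | w.under (𝓞 ℚ) = v},
          ((W.baseChange F).baseChange (w.adicCompletion F)).localEulerFactor
            (w.adicCompletionIntegers F)) *
        ∏ᶠ w ∈ {w : HeightOneSpectrum (𝓞 F) | w.under (𝓞 ℚ) = v},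
          ((W'.baseChange F).baseChange (w.adicCompletion F)).localEulerFactor
            (w.adicCompletionIntegers F) := by
      rw [hT', finprod_mem_biUnion hdisj hT (fun w _ ↦ w.finite_setOf_under_eq_of_numberField),
        ← finprod_mem_mul_distrib hT]
      exact finprod_mem_congr rfl fun w _ ↦ hQ1 w
    /- ### The two identities for the semistable curve `W'`, over `F'` and over `F` -/
    have hC' := W'.intCoe_finprod_localEulerFactor_baseChange_eq_prod_primitiveTwist (m := m) L F' v hv
    obtain ⟨hXun, hXdisj⟩ := characterGroup_adjoin_sqrt L F hθ ψ hψ1 hψ2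
    rw [← hF'def] at hXun
    rw [hXun, Finset.prod_union (hXdisj hθF), ← hXF, ← hB,
      Finset.prod_image (fun χ₁ _ χ₂ _ h ↦ mul_right_cancel h), hC, intCoe_mul] at hC'
    /- ### Cancel the invertible factor `∏_{w ∣ v} L_w(E'_F)⁻¹` -/
    set A : ArithmeticFunction ℂ := ((∏ᶠ w ∈ {w : HeightOneSpectrum (𝓞 F) | w.under (𝓞 ℚ) = v},
        ((W.baseChange F).baseChange (w.adicCompletion F)).localEulerFactor
          (w.adicCompletionIntegers F) : ArithmeticFunction ℤ) : ArithmeticFunction ℂ) with hA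
    set B : ArithmeticFunction ℤ := ∏ᶠ w ∈ {w : HeightOneSpectrum (𝓞 F) | w.under (𝓞 ℚ) = v},
        ((W'.baseChange F).baseChange (w.adicCompletion F)).localEulerFactor
          (w.adicCompletionIntegers F) with hBdef
    set Binv : ArithmeticFunction ℤ := ∏ᶠ w ∈ {w : HeightOneSpectrum (𝓞 F) | w.under (𝓞 ℚ) = v},
        ofPowerSeries w.residueCard (((W'.baseChange F).localPolynomialAt w : ℤ[X]) : PowerSeries ℤ)
      with hBinv
    have hBB : B * Binv = 1 := by
      rw [hBdef, hBinv, ← finprod_mem_mul_distrib hT]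
      exact finprod_mem_of_eqOn_one fun w _ ↦ (W'.baseChange F).localEulerFactor_mul_ofPowerSeries' w
    set R : ArithmeticFunction ℂ := ∏ χ ∈ XF, (toArithmeticFunction fun k : ℕ ↦
        (χ * ψ).primitiveCharacter (k : ZMod (χ * ψ).conductor)).pmul
      (((W'.baseChange (v.adicCompletion ℚ)).localEulerFactor (v.adicCompletionIntegers ℚ) :
        ArithmeticFunction ℤ) : ArithmeticFunction ℂ) with hR
    -- `hC'` reads `A * B = B * R`
    change A * (B : ArithmeticFunction ℂ) = (B : ArithmeticFunction ℂ) * R at hC'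
    calc A = A * (((B * Binv : ArithmeticFunction ℤ) : ArithmeticFunction ℤ) : ArithmeticFunction ℂ) := by
          rw [hBB, intCoe_one, mul_one]
      _ = (A * (B : ArithmeticFunction ℂ)) * (Binv : ArithmeticFunction ℂ) := by
          rw [intCoe_mul, mul_assoc]
      _ = R * (((B * Binv : ArithmeticFunction ℤ) : ArithmeticFunction ℤ) : ArithmeticFunction ℂ) := by
          rw [hC', intCoe_mul, mul_comm (B : ArithmeticFunction ℂ) R, mul_assoc]
      _ = R := by rw [hBB, intCoe_one, mul_one]

end LocalIdentity

end WeierstrassCurve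

end
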